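import Literature.MathematicalPhysics.QuantumFieldTheory.Balaban1983to89.BlockAveragingFederbush

/-!
# Federbush's implicit group average as a TOTAL map: two-sided covariance on ALL families, and the price (no symmetry)

Companion to `BlockAveragingFederbush` (cell pub-balaban / lit-balaban: the implicit average (0.10) of [Balaban1987RG1] p. 253 =
Federbush, CMP **110** (1987) 293–309, (1.1)–(1.2) [Federbush1987PhaseCellIII], constructed there on `U(N)` / `SU(N)` as the TOTAL map
`fedM δ U = (fedSol (U_j U₀*))* U₀` on the guard «all `‖U_i U_k* − 1‖ < δ`», `U₀` off it, with (0.5)–(0.7) proved ON SMALL FAMILIES only).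
Written by the literature seat of cell `pub-ymgap` (track Y4, YM3-IR), whose typed infrared hypothesis `IRConjecture3Cov` pins a block family
to be GAUGE COVARIANT and BLOCK LOCAL as a TOTAL measurable map on all configurations; the printed averages are printed as PARTIAL maps
(Bałaban–Jaffe, *Constructive gauge theory* (Erice 1985) [BalabanJaffe1986] p. 221: (1.26) «uniquely defined for nonsingular X», (1.27) «If the
contour variables … are close to each other, then V is uniquely defined»; Federbush CMP 110 p. 298: «In this paper we will not need to define ḡ
when the minimization does not yield a unique result»), while print states covariance as a basic property of every admissible average
([BalabanJaffe1986] (1.30) `\overline{U^u} = (Ū)^u`; [Balaban1985Averaging] (11); [Balaban1987RG1] (0.6) `M({uU_jv}) = uM({U_j})v`; Federbush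
p. 298 «they preserve gauge invariance»).  This file records, kernel-checked, the two facts that settle how a total completion behaves:

* **`fedM_conj_total`** — the TOTAL map `fedM δ` (`δ ≤ 1/100`) is two-sided equivariant, `fedM δ (u U_j v)_j = u (fedM δ U) v`, on EVERY unitary
  family, small or not: on the guard this is `fedM_conj`; off the guard both sides are the base value `u U₀ v`, because the guard itself is
  invariant (`fedM_guard_conj_iff`, from `norm_conj_mul_sub_one_eq`).  Group level: **`federbushSU_equivariant_total`**,
  **`federbushU_equivariant_total`** (property (0.6) for `Setup.GroupAverage.M` with NO smallness hypothesis), and the citation-ready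
  conjunctions `federbushSU_total` / `federbushU_total` (measurable at every arity ∧ covariant on all families).
* **`federbushU_not_symmetric`** — the price: by the tree's no-go `LoopAverage.no_total_symmetric_equivariant_pair_average` (evaluate a
  symmetric left-`z`-equivariant pair average at `(1, z)`, `z = −1`), a total map that is equivariant everywhere CANNOT be permutation-symmetric
  everywhere; concretely some pair `a, b ∈ U(N)` has `M(a, b) ≠ M(b, a)` — the base-point convention off the guard is where (0.7) is paid, exactly
  as print pays it (Federbush p. 298: «the choice of contours … will vary with the field in the large field region»).

HONEST FRAMING (mega-formalization `lit-balaban`, verbatim): statement-level skeleton of published theorems with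
citation tags; proofs where landed; nothing here is a claim about the Yang–Mills mass gap.

HONEST SCOPE.  [folklore]-grade bookkeeping about a printed object; no printed theorem is asserted; nothing here is a claim about the Yang–Mills
mass gap or about the inhabitation of any `pub-ymgap` conjecture.  Theorems only (no `def`, no named fact); imports `BlockAveragingFederbush` only.
-/

namespace Literature.MathematicalPhysics.QuantumFieldTheory.Balaban1983to89

namespace FederbushMean

noncomputable section

open scoped Matrix.Norms.L2Operator

section Total

variable {n : Type*} [Fintype n] [DecidableEq n] [Nonempty n]
variable {m : ℕ} {δ : ℝ} {U : Fin (m + 1) → Matrix n n ℂ}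

omit [Nonempty n] in
/-- The guard of `fedM` («all quotients `U_i U_k*` within `δ` of `1`») is invariant under two-sided unitary translation
`U_j ↦ u U_j v` — the invariance behind (0.6) «M({uU_jv}) = uM({U_j})v» for the total map. [cite: Balaban1987RG1, (0.6) p.253] -/
theorem fedM_guard_conj_iff {u v : Matrix n n ℂ} (hu : u ∈ Matrix.unitaryGroup n ℂ) (hv : v ∈ Matrix.unitaryGroup n ℂ) :
    (∀ i k, ‖u * U i * v * star (u * U k * v) - 1‖ < δ) ↔ ∀ i k, ‖U i * star (U k) - 1‖ < δ := by
  simp only [norm_conj_mul_sub_one_eq hu hv]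

omit [Nonempty n] in
/-- **TOTAL TWO-SIDED EQUIVARIANCE (0.6) of Federbush's average as a total map**: for `δ ≤ 1/100` and EVERY unitary family
(no smallness hypothesis), `fedM δ (u U_j v)_j = u · fedM δ U · v` for unitary `u, v`.  On the guard = `fedM_conj`; off the
guard both sides equal `u U₀ v` since the guard is invariant. [cite: Balaban1987RG1, (0.6) p.253] -/
theorem fedM_conj_total (hU : ∀ j, U j ∈ Matrix.unitaryGroup n ℂ) (hδ : δ ≤ 1 / 100)
    {u v : Matrix n n ℂ} (hu : u ∈ Matrix.unitaryGroup n ℂ) (hv : v ∈ Matrix.unitaryGroup n ℂ) :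
    fedM δ (fun j => u * U j * v) = u * fedM δ U * v := by
  by_cases h : ∀ i k, ‖U i * star (U k) - 1‖ < δ
  · exact fedM_conj hU hδ h hu hv
  · have h' : ¬ ∀ i k, ‖u * U i * v * star (u * U k * v) - 1‖ < δ := by
      rwa [fedM_guard_conj_iff hu hv]
    rw [fedM_of_not_small h', fedM_of_not_small h]

/-- **(0.6) for the inhabitant `federbushSU : GroupAverage SU(N)` on ALL families** (the structure field `equivariant` asks it
only on `FamilySmall δ` families). [cite: Balaban1987RG1, (0.6) p.253] -/
theorem federbushSU_equivariant_total (U : Fin (m + 1) → Matrix.specialUnitaryGroup n ℂ)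
    (u v : Matrix.specialUnitaryGroup n ℂ) :
    (federbushSU (n := n)).M (fun i => u * U i * v) = u * (federbushSU (n := n)).M U * v := by
  apply Subtype.ext
  show fedM (deltaFed n) (fun j => (u : Matrix n n ℂ) * (U j : Matrix n n ℂ) * (v : Matrix n n ℂ))
    = (u : Matrix n n ℂ) * fedM (deltaFed n) (fun j => (U j : Matrix n n ℂ)) * (v : Matrix n n ℂ)
  exact fedM_conj_total (fun j => (U j).2.1) deltaFed_le u.2.1 v.2.1

/-- **(0.6) for the inhabitant `federbushU : GroupAverage U(N)` on ALL families.** [cite: Balaban1987RG1, (0.6) p.253] -/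
theorem federbushU_equivariant_total (U : Fin (m + 1) → Matrix.unitaryGroup n ℂ) (u v : Matrix.unitaryGroup n ℂ) :
    (federbushU (n := n)).M (fun i => u * U i * v) = u * (federbushU (n := n)).M U * v := by
  apply Subtype.ext
  show fedM (1 / 100) (fun j => (u : Matrix n n ℂ) * (U j : Matrix n n ℂ) * (v : Matrix n n ℂ))
    = (u : Matrix n n ℂ) * fedM (1 / 100) (fun j => (U j : Matrix n n ℂ)) * (v : Matrix n n ℂ)
  exact fedM_conj_total (fun j => (U j).2) le_rfl u.2 v.2

/-- **A TOTAL, MEASURABLE, GAUGE-COVARIANT group average on `SU(N)` exists, at every arity** — Federbush's: the conjunction of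
`federbushSU_measurable` and `federbushSU_equivariant_total`, stated for citation (print: the implicit average (0.10) «has all the
properties listed above», among them (0.6); here (0.6) for the tree's total version of (0.10), with no diameter restriction).
[cite: Balaban1987RG1, (0.6), (0.10) p.253] -/
theorem federbushSU_total (m : ℕ) :
    (Measurable fun U : Fin (m + 1) → Matrix.specialUnitaryGroup n ℂ => (federbushSU (n := n)).M U) ∧
      ∀ (U : Fin (m + 1) → Matrix.specialUnitaryGroup n ℂ) (u v : Matrix.specialUnitaryGroup n ℂ),
        (federbushSU (n := n)).M (fun i => u * U i * v) = u * (federbushSU (n := n)).M U * v :=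
  ⟨federbushSU_measurable m, fun U u v => federbushSU_equivariant_total U u v⟩

/-- The same for `U(N)`. [cite: Balaban1987RG1, (0.6), (0.10) p.253] -/
theorem federbushU_total (m : ℕ) :
    (Measurable fun U : Fin (m + 1) → Matrix.unitaryGroup n ℂ => (federbushU (n := n)).M U) ∧
      ∀ (U : Fin (m + 1) → Matrix.unitaryGroup n ℂ) (u v : Matrix.unitaryGroup n ℂ),
        (federbushU (n := n)).M (fun i => u * U i * v) = u * (federbushU (n := n)).M U * v :=
  ⟨federbushU_measurable m, fun U u v => federbushU_equivariant_total U u v⟩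

/-- `−1 ≠ 1` in `U(N)`, `N ≥ 1` (private helper). [folklore] -/
private theorem neg_one_ne_one_unitaryGroup : (-1 : Matrix.unitaryGroup n ℂ) ≠ 1 := by
  intro h
  have h' : ((-1 : Matrix.unitaryGroup n ℂ) : Matrix n n ℂ) = ((1 : Matrix.unitaryGroup n ℂ) : Matrix n n ℂ) :=
    congrArg Subtype.val h
  rw [Unitary.coe_neg, OneMemClass.coe_one] at h'
  obtain ⟨i⟩ := ‹Nonempty n›
  have hi := congrFun (congrFun h' i) i
  simp only [Matrix.neg_apply, Matrix.one_apply_eq] at hi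
  norm_num at hi

/-- **THE PRICE OF TOTALITY: the total covariant average is NOT permutation-symmetric on all pairs.**  Since `federbushU.M`
is left-`(−1)`-equivariant on EVERY pair (`federbushU_equivariant_total`), the tree's no-go
`LoopAverage.no_total_symmetric_equivariant_pair_average` (at the pair `(1, −1)`: `M(1,z) = M(z,1) = M(z·1, z·z) = z·M(1,z)`)
forbids symmetry on every pair: some `a, b ∈ U(N)` have `M(a, b) ≠ M(b, a)` (the base-point value off the guard).  This is
property (0.7) «M(π{U_j}) = M({U_j}) for an arbitrary permutation π» failing OFF the small-diameter families — print imposes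
(0.5)–(0.7) only on «sets {U_j} … with sufficiently small diameters» (p. 253), and this shows that restriction cannot be dropped for
any total equivariant completion. [cite: Balaban1987RG1, (0.7) p.253] -/
theorem federbushU_not_symmetric :
    ∃ a b : Matrix.unitaryGroup n ℂ, (federbushU (n := n)).M ![a, b] ≠ (federbushU (n := n)).M ![b, a] := by
  by_contra hcon
  have hsymm : ∀ a b : Matrix.unitaryGroup n ℂ, (federbushU (n := n)).M ![a, b] = (federbushU (n := n)).M ![b, a] :=
    fun a b => Classical.byContradiction fun hab => hcon ⟨a, b, hab⟩
  have hz2 : (-1 : Matrix.unitaryGroup n ℂ) * (-1) = 1 := by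
    rw [neg_mul_neg, one_mul]
  refine LoopAverage.no_total_symmetric_equivariant_pair_average (G := Matrix.unitaryGroup n ℂ)
    neg_one_ne_one_unitaryGroup hz2 ⟨fun a b => (federbushU (n := n)).M ![a, b], fun a b => ?_, hsymm⟩
  have h := federbushU_equivariant_total (m := 1) ![a, b] (-1) 1
  have hfun : (fun i => (-1 : Matrix.unitaryGroup n ℂ) * (![a, b] : Fin 2 → Matrix.unitaryGroup n ℂ) i * 1)
      = ![-1 * a, -1 * b] := by
    funext i
    fin_cases i <;> simp
  rw [hfun, mul_one] at h
  exact h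

end Total

/-! ## The price of totality for every `SU(N)`, `N ≥ 2`: cyclic symmetry fails (centre `Z_N`)

`SU(N)` with `N` odd has no central involution, so the pair no-go does not apply verbatim; but the same one-line argument runs
on `k`-tuples with any torsion element `z ≠ 1`, `z^k = 1`: a CYCLICALLY symmetric, left-`z`-equivariant total average `M` would
give `M(1, z, …, z^{k−1}) = M(z, z², …, z^k) = z · M(1, z, …, z^{k−1})`, i.e. `z = 1`.  With `z = e^{2πi/N}·1 ∈ Z_N ⊂ SU(N)` this is
the obstruction for every `N ≥ 2` ((0.7) — «for an arbitrary permutation π of the set {U_j}», in particular the cyclic shift —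
cannot hold on all families once (0.6) does). -/

section Cyclic

/-- **NO TOTAL CYCLICALLY-SYMMETRIC `z`-EQUIVARIANT AVERAGE** on `(k+1)`-tuples, for any group element `z ≠ 1` with `z^{k+1} = 1`:
evaluate at the tuple `(1, z, z², …, z^k)`, whose cyclic shift is its left `z`-translate.  Generalises the tree's pair no-go
`LoopAverage.no_total_symmetric_equivariant_pair_average` (`k = 1`, `z² = 1`); print imposes (0.6)–(0.7) only on small-diameter
families. [cite: Balaban1987RG1, (0.6)–(0.7) p.253] -/
theorem no_total_cyclic_equivariant_average {G : Type*} [Group G] {k : ℕ} {z : G} (hz : z ≠ 1)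
    (hzk : z ^ (k + 1) = 1) :
    ¬ ∃ M : (Fin (k + 1) → G) → G,
      (∀ U : Fin (k + 1) → G, M (fun i => z * U i) = z * M U) ∧
        (∀ U : Fin (k + 1) → G, M (U ∘ finRotate (k + 1)) = M U) := by
  rintro ⟨M, hequi, hcyc⟩
  set U : Fin (k + 1) → G := fun i => z ^ (i : ℕ) with hU_def
  have hshift : U ∘ finRotate (k + 1) = fun i => z * U i := by
    funext i
    simp only [Function.comp_apply, hU_def, finRotate_apply]
    rcases eq_or_ne i (Fin.last k) with h | h
    · subst h
      rw [Fin.last_add_one, Fin.val_zero, pow_zero, Fin.val_last, ← pow_succ', hzk]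
    · rw [Fin.val_add_one_of_lt (Fin.lt_last_iff_ne_last.mpr h), pow_succ']
  have h1 : M U = z * M U := by rw [← hequi U, ← hshift, hcyc U]
  have h2 : z * M U = 1 * M U := by rw [one_mul]; exact h1.symm
  exact hz (mul_right_cancel h2)

variable {n : Type*} [Fintype n] [DecidableEq n] [Nonempty n]

/-- The centre element `e^{2πi/N}·1 ∈ SU(N)` is `≠ 1` and has `N`-th power `1` (`N = |n| ≥ 2`): a torsion witness for the
cyclic no-go in EVERY `SU(N)` (private helper). [folklore] -/
private theorem exists_center_torsion_SU (hN : 2 ≤ Fintype.card n) :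
    ∃ z : Matrix.specialUnitaryGroup n ℂ, z ≠ 1 ∧ z ^ Fintype.card n = 1 := by
  have hN0 : Fintype.card n ≠ 0 := by omega
  have hω := Complex.isPrimitiveRoot_exp (Fintype.card n) hN0
  have hωN : Complex.exp (2 * Real.pi * Complex.I / (Fintype.card n)) ^ Fintype.card n = 1 := hω.pow_eq_one
  have hω1 : Complex.exp (2 * Real.pi * Complex.I / (Fintype.card n)) ≠ 1 := hω.ne_one (by omega)
  set ω : ℂ := Complex.exp (2 * Real.pi * Complex.I / (Fintype.card n)) with hω_def
  have hnorm : ‖ω‖ = 1 := Complex.norm_eq_one_of_pow_eq_one hωN hN0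
  have hmem : ω • (1 : Matrix n n ℂ) ∈ Matrix.specialUnitaryGroup n ℂ := by
    rw [Matrix.mem_specialUnitaryGroup_iff, Matrix.mem_unitaryGroup_iff]
    refine ⟨?_, ?_⟩
    · rw [Matrix.star_eq_conjTranspose, Matrix.conjTranspose_smul, Matrix.conjTranspose_one,
        Matrix.smul_mul, Matrix.one_mul, smul_smul]
      have : ω * star ω = 1 := by
        rw [Complex.star_def, Complex.mul_conj, Complex.normSq_eq_norm_sq, hnorm]; norm_num
      rw [this, one_smul]
    · rw [Matrix.det_smul, Matrix.det_one, mul_one, hωN]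
  refine ⟨⟨ω • (1 : Matrix n n ℂ), hmem⟩, ?_, ?_⟩
  · intro h
    have h' := congrArg Subtype.val h
    simp only [OneMemClass.coe_one] at h'
    obtain ⟨i⟩ := ‹Nonempty n›
    have hi := congrFun (congrFun h' i) i
    simp only [Matrix.smul_apply, Matrix.one_apply_eq, smul_eq_mul, mul_one] at hi
    exact hω1 hi
  · apply Subtype.ext
    rw [SubmonoidClass.coe_pow, OneMemClass.coe_one]
    show (ω • (1 : Matrix n n ℂ)) ^ Fintype.card n = 1
    rw [smul_pow, one_pow, hωN, one_smul]

/-- **THE PRICE OF TOTALITY IN EVERY `SU(N)`, `N ≥ 2`: Federbush's total covariant average is NOT cyclically symmetric on all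
families** of any arity divisible by `N` — from `federbushSU_equivariant_total` and `no_total_cyclic_equivariant_average` with the
centre element `e^{2πi/N}·1`.  ((0.7) holds on small families, `GroupAverage.perm`; it cannot hold on all.) [cite: Balaban1987RG1, (0.7) p.253] -/
theorem federbushSU_not_cyclic_symmetric (hN : 2 ≤ Fintype.card n) {m : ℕ} (hm : Fintype.card n ∣ m + 1) :
    ∃ U : Fin (m + 1) → Matrix.specialUnitaryGroup n ℂ,
      (federbushSU (n := n)).M (U ∘ finRotate (m + 1)) ≠ (federbushSU (n := n)).M U := by
  obtain ⟨z, hz1, hzN⟩ := exists_center_torsion_SU (n := n) hN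
  have hzm : z ^ (m + 1) = 1 := by
    obtain ⟨j, hj⟩ := hm
    rw [hj, pow_mul, hzN, one_pow]
  by_contra hcon
  have hcyc : ∀ U : Fin (m + 1) → Matrix.specialUnitaryGroup n ℂ,
      (federbushSU (n := n)).M (U ∘ finRotate (m + 1)) = (federbushSU (n := n)).M U :=
    fun U => Classical.byContradiction fun hU => hcon ⟨U, hU⟩
  refine no_total_cyclic_equivariant_average hz1 hzm ⟨fun U => (federbushSU (n := n)).M U, fun U => ?_, hcyc⟩
  have h := federbushSU_equivariant_total U z 1
  simp only [mul_one] at h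
  exact h

end Cyclic

end

end FederbushMean

end Literature.MathematicalPhysics.QuantumFieldTheory.Balaban1983to89
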